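import Summits.ResolutionOfSingularities.ResolutionOfSingularities.Theorems.WildQuotientsSummitReductionStubPairOrbitBlowupCentreLocalLemmas
import Literature.AlgebraicGeometry.Resolution.AlterationsSemiStableCodimTwoBlowupFlat
import Literature.AlgebraicGeometry.Resolution.AlterationsSemiStableCodimTwoBlowupReduction
import HarnessLib

/-!
# `WildQuotients.SummitReduction` (stmt-ResolutionOfSingularities-16324), line `FramePerfect`:
# the completed local rings of a blow-up of the formal model `Spec Λ⟦u, v⟧/(uv - c t²)` at its
# points over the closed point are completed local rings of the three algebraic charts
# (geometry of stub `stub_pair_orbitBlowupCentreLocal`, file 2: "completion commutes with blowing up")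

Route `ResolutionOfSingularities/WildQuotients`, crux `SummitReduction`; helper file of stub
`stub_pair_orbitBlowupCentreLocal` (C2: de Jong 1996, 3.4 Claim (ii) over the orbit centre) of the
line skeleton `Cruxes/SummitReduction/Lines/FramePerfect.lean` (v8). De Jong 1996, p. 64: "We remark
that completion and blowing up commute in a suitable manner, so that it suffices to compute the blow
up of `Spec B'` (3.3) in the ideal `(u, v, t₁)`. … This blow up is covered by three affine charts
(corresponding to the coordinates `u, v, t₁`); we just give the affine algebras and the reader may
read of properties (i)–(iv) from this." This file PROVES the comparison the reader needs for that:

* `exists_localCpl_equiv_of_chart_of_iso_pullback` — abstract form: for a `B`-scheme `P'` with a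
  chart `Spec S → P'` over `B`, a `B`-algebra `N` bijective on all levels of an ideal below the
  chart point, and `P ≅ P' ×_{Spec B} Spec N` over `Spec N`, the completed local ring of `P` at a
  point over the chart point is the completed local ring of `S_s ≅ R_𝔔`, compatibly with a common
  base ring `Λ` (file 1 for the base change, the open chart and the localization for the rest);
* `exists_chart_localCpl_equiv_of_isBlowup_nodeDeformationRing` — **for ANY blow-up `P` of the
  formal model `Spec Λ⟦u, v⟧/(uv - c t²)` (`NodeDeformationRing`, `Λ` local Noetherian, `t` a
  non-zero-divisor) in `(u, v, t)` and any point `p` over the closed point, `𝒪̂_{P,p}` is the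
  completion of one of the chart rings `Λ[U, T']/(UT' - t)`, `Λ[V, T']/(VT' - t)`,
  `Λ[U', V']/(U'V' - c)` (`AlgebraicNodeRing Λ (chartParam Λ c t j)`) at a prime `𝔔` over `𝔪_Λ`,
  compatibly with `Λ`**: `P` is the base change of a blow-up `P'` of the algebraic model
  `B' = Λ[u, v]/(uv - c t²)` along the flat `Spec B̂' → Spec B'` (GW 13.91 (2), `IsBlowup.unique`),
  `B' → B̂'` is bijective on the levels of `𝔪₀ = 𝔪_Λ B' + (u, v)` (3.3), and `P'` is covered by the
  spectra of the three affine blowup algebras (Stacks 0804, `exists_ringEquiv_blowupAlgebra_nodalCentre`).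
-/

set_option linter.dupNamespace false

noncomputable section

open CategoryTheory CategoryTheory.Limits AlgebraicGeometry TopologicalSpace TensorProduct
open Literature.AlgebraicGeometry.Resolution
open IsLocalRing Scheme.IdealSheafData

namespace Summit.ResolutionOfSingularities.ResolutionOfSingularities.Theorems

universe u

/-! ## Completed local rings of a base change with an affine chart downstairs (abstract form) -/

section AbstractChart

variable {Λ B N S R : Type u} [CommRing Λ] [CommRing B] [CommRing N] [CommRing S] [CommRing R]
  [Algebra Λ B] [Algebra B N] [Algebra Λ N] [IsScalarTower Λ B N] [Algebra B S] [Algebra Λ R]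

/-- **Abstract form of "completion commutes with blowing up".** Let `ρ' : P' → Spec B` be a
`B`-scheme with a chart `φ : Spec S → P'` over `B` inducing an isomorphism on the stalk at `s`, let
`B → N` be bijective on all levels of an ideal `𝔭` contained in the prime of `ρ' (φ s)`, and let
`e : P ≅ P' ×_{Spec B} Spec N` over `ρ : P → Spec N` with `pr₁ (e p) = φ s`. Then, for a ring
isomorphism `ej : R ≅ S` compatible with the structure maps from `Λ`, the completed local ring of
`P` at `p` is the completed local ring of `R_𝔔`, `𝔔 = ej⁻¹(𝔮_s)`, compatibly with `Λ`. [folklore] -/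
theorem exists_localCpl_equiv_of_chart_of_iso_pullback
    (ej : R ≃+* S) (hej : (algebraMap B S).comp (algebraMap Λ B) = ej.toRingHom.comp (algebraMap Λ R))
    {P P' : Scheme.{u}} (ρ : P ⟶ Spec (.of N)) (ρ' : P' ⟶ Spec (.of B))
    (e : P ≅ pullback ρ' (specOfAlgebra B N)) (he : e.hom ≫ pullback.snd ρ' (specOfAlgebra B N) = ρ)
    (φ : Spec (.of S) ⟶ P') (hφ : φ ≫ ρ' = Spec.map (CommRingCat.ofHom (algebraMap B S)))
    (s : Spec (.of S)) [IsIso (φ.stalkMap s)] (p : P)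
    (hs : φ s = pullback.fst ρ' (specOfAlgebra B N) (e.hom p)) (𝔭 : Ideal B)
    (hlev : ∀ n, Function.Bijective
      (Ideal.quotientMap ((𝔭 ^ n).map (algebraMap B N)) (algebraMap B N) Ideal.le_comap_map))
    (h𝔭 : 𝔭 ≤ (ρ' (φ s)).asIdeal) :
    haveI : (s.asIdeal.comap ej.toRingHom).IsPrime := Ideal.comap_isPrime _ _
    ∃ E : LocalCpl (P.presheaf.stalk p) ≃+* LocalCpl (Localization.AtPrime (s.asIdeal.comap ej.toRingHom)),
      ∀ a : Λ, E (AdicCompletion.of _ _ (algebraMap Λ (StalkOver (ρ ≫ Spec.map (CommRingCat.ofHom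
          (algebraMap Λ N))) p) a)) =
        AdicCompletion.of _ _ (algebraMap Λ (Localization.AtPrime (s.asIdeal.comap ej.toRingHom)) a) := by
  haveI h𝔔p : (s.asIdeal.comap ej.toRingHom).IsPrime := Ideal.comap_isPrime _ _
  have hfac : Spec.map (CommRingCat.ofHom (algebraMap Λ N)) =
      specOfAlgebra B N ≫ Spec.map (CommRingCat.ofHom (algebraMap Λ B)) := by
    rw [specOfAlgebra, ← Spec.map_comp, ← CommRingCat.ofHom_comp, ← IsScalarTower.algebraMap_eq]
  have h𝔫 : 𝔭.map (algebraMap _ (StalkOver ρ' (φ s))) ≤ localMaxIdeal (StalkOver ρ' (φ s)) :=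
    map_le_localMaxIdeal_of_le_asIdeal ρ' (φ s) h𝔭
  -- (1) `𝒪̂_{P', φ s} ≅ 𝒪̂_{P'', e p}` compatibly with `pr₁`
  obtain ⟨E₁, hE₁⟩ := exists_localCpl_equiv_stalk_pullback_forall_of N ρ' (φ s) 𝔭 hlev h𝔫 (e.hom p) hs.symm
  -- (2) `𝒪_{P'', e p} ≅ 𝒪_{P, p}` along `e`
  obtain ⟨E₂, hE₂⟩ := exists_localCpl_equiv_of_ringEquiv
    (asIso (e.hom.stalkMap p)).commRingCatIsoToRingEquiv
  -- (3) `𝒪_{P', φ s} ≅ 𝒪_{Spec S, s} ≅ S_s ≅ R_𝔔`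
  have hφΛ : φ ≫ ρ' ≫ Spec.map (CommRingCat.ofHom (algebraMap Λ B)) =
      Spec.map (CommRingCat.ofHom ((algebraMap B S).comp (algebraMap Λ B))) := by
    rw [← Category.assoc, hφ, ← Spec.map_comp, ← CommRingCat.ofHom_comp]
  obtain ⟨ε₄, hε₄⟩ := exists_stalk_ringEquiv_localization_specMap ((algebraMap B S).comp (algebraMap Λ B)) s
  obtain ⟨ε₅, hε₅⟩ := exists_localization_ringEquiv_of_ringEquiv ej s.asIdeal
  let ε₃ : StalkOver ρ' (φ s) ≃+* ↥((Spec (.of S)).presheaf.stalk s) :=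
    (asIso (φ.stalkMap s)).commRingCatIsoToRingEquiv
  obtain ⟨E₃, hE₃⟩ := exists_localCpl_equiv_of_ringEquiv ((ε₃.trans ε₄).trans ε₅)
  refine ⟨(E₂.symm.trans E₁.symm).trans E₃, fun a => ?_⟩
  -- the structure morphisms to `Spec Λ`
  have hfst : pullback.fst ρ' (specOfAlgebra B N) ≫ ρ' ≫ Spec.map (CommRingCat.ofHom (algebraMap Λ B)) =
      pullback.snd ρ' (specOfAlgebra B N) ≫ Spec.map (CommRingCat.ofHom (algebraMap Λ N)) := by
    rw [← Category.assoc, pullback.condition, Category.assoc, ← hfac]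
  have hehom : e.hom ≫ pullback.snd ρ' (specOfAlgebra B N) ≫ Spec.map (CommRingCat.ofHom (algebraMap Λ N)) =
      ρ ≫ Spec.map (CommRingCat.ofHom (algebraMap Λ N)) := by
    rw [← Category.assoc, he]
  -- step (2)
  have x2 : (e.hom.stalkMap p).hom (algebraMap Λ (StalkOver (pullback.snd ρ' (specOfAlgebra B N) ≫
      Spec.map (CommRingCat.ofHom (algebraMap Λ N))) (e.hom p)) a) =
      algebraMap Λ (StalkOver (ρ ≫ Spec.map (CommRingCat.ofHom (algebraMap Λ N))) p) a :=
    stalkMap_algebraMap_stalkOver e.hom _ _ hehom p a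
  have s2 := (hE₂ _).trans (congrArg _ x2)
  -- step (1)
  have x1 : ((pullback.fst ρ' (specOfAlgebra B N)).stalkMap (e.hom p)).hom
      ((P'.presheaf.stalkCongr (.of_eq hs.symm.symm)).hom (algebraMap Λ (StalkOver (ρ' ≫
        Spec.map (CommRingCat.ofHom (algebraMap Λ B))) (φ s)) a)) =
      algebraMap Λ (StalkOver (pullback.snd ρ' (specOfAlgebra B N) ≫
        Spec.map (CommRingCat.ofHom (algebraMap Λ N))) (e.hom p)) a := by
    rw [stalkCongr_algebraMap_stalkOver (ρ' ≫ Spec.map (CommRingCat.ofHom (algebraMap Λ B))) hs a]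
    exact stalkMap_algebraMap_stalkOver (pullback.fst ρ' (specOfAlgebra B N)) _ _ hfst (e.hom p) a
  have s1 := (hE₁ _).trans (congrArg _ x1)
  -- step (3)
  have s3 : (((ε₃.trans ε₄).trans ε₅)
      (algebraMap Λ (StalkOver (ρ' ≫ Spec.map (CommRingCat.ofHom (algebraMap Λ B))) (φ s)) a)) =
      algebraMap Λ _ a := by
    have h1 := stalkMap_algebraMap_stalkOver φ _ _ hφΛ s a
    have h2 : ((algebraMap B S).comp (algebraMap Λ B)) a = ej (algebraMap Λ R a) :=
      congrArg (fun f => f a) hej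
    change ε₅ (ε₄ ((φ.stalkMap s).hom (algebraMap Λ (StalkOver (ρ' ≫
      Spec.map (CommRingCat.ofHom (algebraMap Λ B))) (φ s)) a))) = _
    rw [h1, hε₄, h2, hε₅]
    exact (IsScalarTower.algebraMap_apply Λ R _ a).symm
  -- assemble
  rw [RingEquiv.trans_apply, RingEquiv.trans_apply, (E₂.symm_apply_eq).mpr s2.symm,
    (E₁.symm_apply_eq).mpr s1.symm, hE₃, s3]

end AbstractChart

/-! ## The completed local rings of a blow-up of the formal model -/

section FormalBlowupCharts

open DeJong1996 DeJong1996.AlgebraicNodeRing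

/-- **"Completion and blowing up commute in a suitable manner, so that it suffices to compute the
blow up of `Spec B'`" (de Jong 1996, p. 64): the completed local ring of ANY blow-up `P` of the
formal model `Spec Λ⟦u, v⟧/(uv - c t²)` (`NodeDeformationRing`, local for `Λ` local) in
`(u, v, t)`, at a point `p` over the closed point, is the completed local ring of one of the three
algebraic chart rings `Λ[U, T']/(UT' - t)`, `Λ[V, T']/(VT' - t)`, `Λ[U', V']/(U'V' - c)`
(`AlgebraicNodeRing Λ (chartParam Λ c t j)`) at a prime `𝔔`, compatibly with the structure maps
from `Λ`.** Proof: `P` is the base change of a blow-up `P'` of the algebraic model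
`B' = Λ[u, v]/(uv - c t²)` along the flat `Spec B̂' → Spec B'` (GW 13.91 (2), `IsBlowup.unique`);
`B' → B̂'` is bijective on all levels of the maximal ideal `𝔪₀ = 𝔪_Λ B' + (u, v)` (3.3: "`B` is the
completion of the algebra `B'` at the maximal ideal `𝔪_{A'}B' + (u, v)B'`"), so the completed local
ring of `P` at `p` is that of `P'` at the image `p'` of `p` (`StalkBaseChangeCompletion`); and `P'`
is covered by the spectra of the three affine blowup algebras (Stacks 0804), which are the chart
rings (`exists_ringEquiv_blowupAlgebra_nodalCentre`). [cite: DeJong1996, 3.3–3.4, pp. 63–64] -/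
theorem exists_chart_localCpl_equiv_of_isBlowup_nodeDeformationRing (Λ : Type u) [CommRing Λ]
    [IsNoetherianRing Λ] (c t : Λ) [IsLocalRing Λ]
    [IsLocalRing (NodeDeformationRing Λ (c * t ^ 2))] (ht : t ∈ nonZeroDivisors Λ)
    {P : Scheme.{u}} (ρ : P ⟶ Spec (.of (NodeDeformationRing Λ (c * t ^ 2))))
    (hρ : IsBlowup ρ (ofIdealTop
      ((((nodalCentre Λ c t).map
        (AlgebraicNodeRing.toNodeDeformationRing Λ (c * t ^ 2)).toRingHom)).map
        (Scheme.ΓSpecIso (.of (NodeDeformationRing Λ (c * t ^ 2)))).inv.hom)))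
    (p : P) (hp : ρ p = closedPoint (NodeDeformationRing Λ (c * t ^ 2))) :
    ∃ (j : Fin 3) (𝔔 : Ideal (AlgebraicNodeRing Λ (chartParam Λ c t j))) (_ : 𝔔.IsPrime)
      (E : LocalCpl (P.presheaf.stalk p) ≃+* LocalCpl (Localization.AtPrime 𝔔)),
      (maximalIdeal Λ).map (algebraMap Λ (AlgebraicNodeRing Λ (chartParam Λ c t j))) ≤ 𝔔 ∧
      ∀ a : Λ, E (AdicCompletion.of _ _ (algebraMap Λ (StalkOver (ρ ≫ Spec.map (CommRingCat.ofHom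
          (algebraMap Λ (NodeDeformationRing Λ (c * t ^ 2))))) p) a)) =
        AdicCompletion.of _ _ (algebraMap Λ (Localization.AtPrime 𝔔) a) := by
  classical
  -- notation (plain `let`s would be abstracted by later `obtain`s, so we fix abbreviations first)
  obtain ⟨B, hB⟩ : ∃ B : Type u, B = AlgebraicNodeRing Λ (c * t ^ 2) := ⟨_, rfl⟩
  subst hB
  letI algBN : Algebra (AlgebraicNodeRing Λ (c * t ^ 2)) (NodeDeformationRing Λ (c * t ^ 2)) :=
    (AlgebraicNodeRing.toNodeDeformationRing Λ (c * t ^ 2)).toRingHom.toAlgebra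
  have halg : (algebraMap (AlgebraicNodeRing Λ (c * t ^ 2)) (NodeDeformationRing Λ (c * t ^ 2)) :
      _ →+* _) = (AlgebraicNodeRing.toNodeDeformationRing Λ (c * t ^ 2)).toRingHom := rfl
  have hfac : Spec.map (CommRingCat.ofHom (algebraMap Λ (NodeDeformationRing Λ (c * t ^ 2)))) =
      specOfAlgebra (AlgebraicNodeRing Λ (c * t ^ 2)) (NodeDeformationRing Λ (c * t ^ 2)) ≫
        Spec.map (CommRingCat.ofHom (algebraMap Λ (AlgebraicNodeRing Λ (c * t ^ 2)))) := by
    rw [specOfAlgebra, halg, ← Spec.map_comp, ← CommRingCat.ofHom_comp, AlgHom.toRingHom_eq_coe,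
      AlgHom.comp_algebraMap]
  -- `u, v ∈ 𝔪_N`
  have hXmem : ∀ i : Fin 2, (Ideal.Quotient.mk (Ideal.span {nodeDeformationRelation Λ (c * t ^ 2)})
      (MvPowerSeries.X i) : NodeDeformationRing Λ (c * t ^ 2)) ∈
        maximalIdeal (NodeDeformationRing Λ (c * t ^ 2)) := fun i => by
    haveI : IsLocalHom (Ideal.Quotient.mk (Ideal.span {nodeDeformationRelation Λ (c * t ^ 2)})) :=
      IsLocalHom.of_surjective _ Ideal.Quotient.mk_surjective
    rw [mem_maximalIdeal, mem_nonunits_iff]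
    intro hu
    have h1 := (isUnit_map_iff (Ideal.Quotient.mk (Ideal.span {nodeDeformationRelation Λ (c * t ^ 2)}))
      (MvPowerSeries.X i)).mp hu
    rw [MvPowerSeries.isUnit_iff_constantCoeff, MvPowerSeries.constantCoeff_X] at h1
    exact not_isUnit_zero h1
  -- the maximal ideal `𝔪₀ = τ⁻¹(𝔪_N)` of `B'` is level-bijective for `B' → N`
  have huv : Ideal.span {u Λ (c * t ^ 2), v Λ (c * t ^ 2)} ≤
      (maximalIdeal (NodeDeformationRing Λ (c * t ^ 2))).comap
        (algebraMap (AlgebraicNodeRing Λ (c * t ^ 2)) (NodeDeformationRing Λ (c * t ^ 2))) := by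
    rw [Ideal.span_le]
    rintro x (rfl | hx)
    · change (AlgebraicNodeRing.toNodeDeformationRing Λ (c * t ^ 2)).toRingHom (u Λ (c * t ^ 2)) ∈
        maximalIdeal _
      rw [show (AlgebraicNodeRing.toNodeDeformationRing Λ (c * t ^ 2)).toRingHom (u Λ (c * t ^ 2)) =
        Ideal.Quotient.mk _ (MvPowerSeries.X 0) from AlgebraicNodeRing.lift_u _ _ _]
      exact hXmem 0
    · rw [Set.mem_singleton_iff] at hx
      subst hx
      change (AlgebraicNodeRing.toNodeDeformationRing Λ (c * t ^ 2)).toRingHom (v Λ (c * t ^ 2)) ∈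
        maximalIdeal _
      rw [show (AlgebraicNodeRing.toNodeDeformationRing Λ (c * t ^ 2)).toRingHom (v Λ (c * t ^ 2)) =
        Ideal.Quotient.mk _ (MvPowerSeries.X 1) from AlgebraicNodeRing.lift_v _ _ _]
      exact hXmem 1
  have hlev : ∀ n, Function.Bijective (Ideal.quotientMap
      ((((maximalIdeal (NodeDeformationRing Λ (c * t ^ 2))).comap
        (algebraMap (AlgebraicNodeRing Λ (c * t ^ 2)) (NodeDeformationRing Λ (c * t ^ 2)))) ^ n).map
        (algebraMap (AlgebraicNodeRing Λ (c * t ^ 2)) (NodeDeformationRing Λ (c * t ^ 2))))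
      (algebraMap (AlgebraicNodeRing Λ (c * t ^ 2)) (NodeDeformationRing Λ (c * t ^ 2)))
      Ideal.le_comap_map) := fun n =>
    quotientMap_pow_bijective_toNodeDeformationRing Λ _ _ huv n
  -- a blow-up of the algebraic model; `P` is its base change along `Spec N → Spec B'`
  obtain ⟨P', ρ', hρ'⟩ := exists_isBlowup (Spec (.of (AlgebraicNodeRing Λ (c * t ^ 2))))
    (ofIdealTop ((nodalCentre Λ c t).map (Scheme.ΓSpecIso (.of (AlgebraicNodeRing Λ (c * t ^ 2)))).inv.hom))
  haveI : Flat (specOfAlgebra (AlgebraicNodeRing Λ (c * t ^ 2)) (NodeDeformationRing Λ (c * t ^ 2))) :=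
    Flat.SpecMap_iff.mpr (AlgebraicNodeRing.flat_toNodeDeformationRing Λ _)
  have hbc := hρ'.pullback_snd_of_flat
    (specOfAlgebra (AlgebraicNodeRing Λ (c * t ^ 2)) (NodeDeformationRing Λ (c * t ^ 2)))
  rw [comap_ofIdealTop_SpecMap] at hbc
  obtain ⟨e, he, -⟩ := hρ.unique hbc
  -- the chart of `P'` at `p' = pr₁ (e p)`
  obtain ⟨j, φ, _, ⟨s, hs⟩, hφ⟩ := hρ'.exists_chart_of_span_range_eq _
    (nodalCentre_eq_span_range_centreGen Λ c t).symm
    (pullback.fst ρ' (specOfAlgebra _ (NodeDeformationRing Λ (c * t ^ 2))) (e.hom p))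
  obtain ⟨ej, hej⟩ := exists_ringEquiv_blowupAlgebra_nodalCentre Λ c t ht j
  -- the image of `φ s` in `Spec B'` is `𝔪₀ ⊇ 𝔪_Λ B'`
  have hsnd : pullback.snd ρ' (specOfAlgebra _ (NodeDeformationRing Λ (c * t ^ 2))) (e.hom p) =
      closedPoint (NodeDeformationRing Λ (c * t ^ 2)) := by
    rw [← Scheme.Hom.comp_apply, he, hp]
  have hρ'p' : (ρ' (φ s)).asIdeal = (maximalIdeal (NodeDeformationRing Λ (c * t ^ 2))).comap
      (algebraMap (AlgebraicNodeRing Λ (c * t ^ 2)) (NodeDeformationRing Λ (c * t ^ 2))) := by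
    rw [hs, ← Scheme.Hom.comp_apply, pullback.condition, Scheme.Hom.comp_apply, hsnd]
    rfl
  -- the abstract comparison
  letI : Algebra Λ (AlgebraicNodeRing Λ (chartParam Λ c t j)) := inferInstance
  obtain ⟨E, hE⟩ := exists_localCpl_equiv_of_chart_of_iso_pullback (Λ := Λ) ej hej ρ ρ' e he φ hφ s p
    hs (𝔭 := (maximalIdeal (NodeDeformationRing Λ (c * t ^ 2))).comap
      (algebraMap (AlgebraicNodeRing Λ (c * t ^ 2)) (NodeDeformationRing Λ (c * t ^ 2)))) hlev
    (by rw [hρ'p'])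
  refine ⟨j, _, Ideal.comap_isPrime _ _, E, ?_, hE⟩
  -- `𝔔` lies over `𝔪_Λ`
  rw [Ideal.map_le_iff_le_comap]
  intro a ha
  rw [Ideal.mem_comap, Ideal.mem_comap]
  have h1 : ej (algebraMap Λ (AlgebraicNodeRing Λ (chartParam Λ c t j)) a) =
      algebraMap (AlgebraicNodeRing Λ (c * t ^ 2)) (blowupAlgebra (nodalCentre Λ c t) (centreGen Λ c t j))
        (algebraMap Λ (AlgebraicNodeRing Λ (c * t ^ 2)) a) := by
    have := congrArg (fun f => f a) hej
    simpa using this.symm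
  change ej.toRingHom _ ∈ s.asIdeal
  rw [RingEquiv.toRingHom_eq_coe, RingHom.coe_coe, h1]
  have h2 : (ρ' (φ s)).asIdeal = s.asIdeal.comap (algebraMap (AlgebraicNodeRing Λ (c * t ^ 2))
      (blowupAlgebra (nodalCentre Λ c t) (centreGen Λ c t j))) := by
    rw [← Scheme.Hom.comp_apply, hφ, Spec.map_apply]
    rfl
  have h3 : algebraMap Λ (AlgebraicNodeRing Λ (c * t ^ 2)) a ∈ (ρ' (φ s)).asIdeal := by
    rw [hρ'p', Ideal.mem_comap, halg, AlgHom.toRingHom_eq_coe, RingHom.coe_coe, AlgHom.commutes]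
    -- `Λ → N` is local
    haveI : IsLocalHom (Ideal.Quotient.mk (Ideal.span {nodeDeformationRelation Λ (c * t ^ 2)})) :=
      IsLocalHom.of_surjective _ Ideal.Quotient.mk_surjective
    rw [mem_maximalIdeal, mem_nonunits_iff]
    intro hu
    have hu' := (isUnit_map_iff (Ideal.Quotient.mk (Ideal.span {nodeDeformationRelation Λ (c * t ^ 2)}))
      (MvPowerSeries.C a : MvPowerSeries (Fin 2) Λ)).mp hu
    rw [MvPowerSeries.isUnit_iff_constantCoeff, MvPowerSeries.constantCoeff_C] at hu'
    exact ((mem_maximalIdeal a).mp ha) hu'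
  rw [h2, Ideal.mem_comap] at h3
  exact h3

end FormalBlowupCharts

end Summit.ResolutionOfSingularities.ResolutionOfSingularities.Theorems

end
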